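import Summits.Ventures.PercRepro.ExcessOneSingleton

/-!
# (SD), class form: every nontrivial twin class of a family of excess at most one is a
difference

`cls_mem_diffs_of_card_diffs_le`: if `|F \\ F| ≤ |F| + 1` and `a` lies in some member and
outside some member, then the twin class `cls F a` is a difference of `F`. This is the class form
of Theorem (SD) (`ExcessOneSingleton.lean`, proofs/MINE1-theoremS.md Addendum 20), obtained by
the twin reduction: if `a` has a twin `b ≠ a`, the projection along `b` keeps `|F|` and `|F \\ F|`
(`t ↦ t.erase b` is injective on `F` and on `F \\ F`, both consisting of twin-closed sets), shrinks
the class of `a` by `b`, and a difference `d` of `F` with `d.erase b = (cls F a).erase b` must be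
`cls F a` itself.
-/

namespace PercRepro.MSTight

open Finset
open scoped FinsetFamily

variable {α : Type*} [DecidableEq α]

section TwinReduction

variable {F : Finset (Finset α)} {a b : α}

/-- The projection along `b` is `t ↦ t \ {b}`. -/
theorem proj_eq_image_sdiff (b : α) (F : Finset (Finset α)) :
    proj b F = F.image fun t => t \ {b} := by
  unfold proj
  congr 1
  ext t
  rw [erase_eq]

/-- Along a twin `b` of `a`, the projection is injective on twin-closed sets. -/
theorem erase_injOn_of_twin (hab : Twin F a b) (hne : a ≠ b) {G : Finset (Finset α)}
    (hG : ∀ t ∈ G, TwinClosed F t) : Set.InjOn (fun t : Finset α => t.erase b) (G : Set (Finset α)) := by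
  intro t ht t' ht' h
  rw [mem_coe] at ht ht'
  have h' : t.erase b = t'.erase b := h
  have key : ∀ s ∈ G, b ∈ s ↔ a ∈ s.erase b := by
    intro s hs
    rw [mem_erase]
    constructor
    · intro hbs
      exact ⟨hne, hG s hs b a hab.symm hbs⟩
    · rintro ⟨-, has⟩
      exact hG s hs a b hab has
  ext x
  by_cases hxb : x = b
  · subst hxb
    rw [key t ht, key t' ht', h']
  · have h1 : x ∈ t ↔ x ∈ t.erase b := by
      rw [mem_erase]
      exact ⟨fun hx => ⟨hxb, hx⟩, fun hx => hx.2⟩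
    have h2 : x ∈ t' ↔ x ∈ t'.erase b := by
      rw [mem_erase]
      exact ⟨fun hx => ⟨hxb, hx⟩, fun hx => hx.2⟩
    rw [h1, h2, h']

/-- Along a twin `b` of `a`, the projection keeps the number of members. -/
theorem card_proj_of_twin (hab : Twin F a b) (hne : a ≠ b) : (proj b F).card = F.card := by
  unfold proj
  exact card_image_of_injOn (erase_injOn_of_twin hab hne fun t ht => twinClosed_of_mem ht)

/-- Along a twin `b` of `a`, the projection keeps the number of differences. -/
theorem card_diffs_proj_of_twin (hab : Twin F a b) (hne : a ≠ b) :
    (proj b F \\ proj b F).card = (F \\ F).card := by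
  rw [proj_eq_image_sdiff, diffs_image_sdiff]
  have h : ((F \\ F).image fun d => d \ {b}) = (F \\ F).image fun d => d.erase b := by
    congr 1
    ext d
    rw [erase_eq]
  rw [h]
  exact card_image_of_injOn (erase_injOn_of_twin hab hne fun d hd => twinClosed_of_mem_diffs hd)

variable [Fintype α]

/-- The twin class of `a ≠ b` in the projection along `b` is the class of `a` in `F` with `b`
removed, provided `a` lies in some member. -/
theorem cls_proj_eq_erase (hne : a ≠ b) (hin : ∃ t ∈ F, a ∈ t) :
    cls (proj b F) a = (cls F a).erase b := by
  ext y
  rw [mem_cls, mem_erase, mem_cls]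
  by_cases hyb : y = b
  · subst hyb
    simp only [ne_eq, not_true_eq_false, false_and, iff_false]
    intro hy
    obtain ⟨t, ht, hat⟩ := hin
    have h := hy (t.erase y) (mem_proj.2 ⟨t, ht, rfl⟩)
    rw [mem_erase, mem_erase] at h
    exact (h.1 ⟨hne, hat⟩).1 rfl
  · simp only [ne_eq, hyb, not_false_eq_true, true_and]
    constructor
    · intro hy t ht
      have h := hy (t.erase b) (mem_proj.2 ⟨t, ht, rfl⟩)
      rw [mem_erase, mem_erase] at h
      constructor
      · intro hat
        exact (h.1 ⟨hne, hat⟩).2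
      · intro hyt
        exact (h.2 ⟨hyb, hyt⟩).2
    · intro hy t ht
      obtain ⟨s, hs, rfl⟩ := mem_proj.1 ht
      rw [mem_erase, mem_erase]
      constructor
      · rintro ⟨-, has⟩
        exact ⟨hyb, (hy s hs).1 has⟩
      · rintro ⟨-, hys⟩
        exact ⟨hne, (hy s hs).2 hys⟩

end TwinReduction

section ClassForm

variable [Fintype α]

/-- **(SD), class form, with an explicit support.** -/
theorem cls_mem_diffs_of_card_diffs_le_aux (u : Finset α) :
    ∀ (F : Finset (Finset α)), (∀ t ∈ F, t ⊆ u) → (F \\ F).card ≤ F.card + 1 →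
      ∀ a : α, (∃ t ∈ F, a ∈ t) → (∃ t ∈ F, a ∉ t) → cls F a ∈ F \\ F := by
  induction u using Finset.strongInduction with
  | H u ih =>
  intro F hFu hF a hin hout
  by_cases htw : ∀ b, Twin F a b → b = a
  · have h := singleton_mem_diffs_of_card_diffs_le hF htw hin hout
    have hcls : cls F a = {a} := by
      ext b
      rw [mem_cls, mem_singleton]
      constructor
      · exact htw b
      · rintro rfl
        exact twin_refl F _
    rw [hcls]
    exact h
  · push Not at htw
    obtain ⟨b, hab, hba⟩ := htw
    have hne : a ≠ b := fun h => hba h.symm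
    obtain ⟨t₀, ht₀, hat₀⟩ := hin
    have hbu : b ∈ u := hFu t₀ ht₀ ((hab t₀ ht₀).1 hat₀)
    have h := ih (u.erase b) (erase_ssubset hbu) (proj b F) ?_ ?_ a ?_ ?_
    · rw [cls_proj_eq_erase hne ⟨t₀, ht₀, hat₀⟩, diffs_proj_eq, mem_union, mem_diffsX_iff,
        mem_diffsY_iff] at h
      rcases h with ⟨h, -⟩ | ⟨-, h⟩
      · exfalso
        have hb : b ∈ (cls F a).erase b :=
          twinClosed_of_mem_diffs h a b hab (mem_erase.2 ⟨hne, self_mem_cls F a⟩)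
        exact (mem_erase.1 hb).1 rfl
      · rwa [insert_erase (mem_cls.2 hab)] at h
    · intro t ht
      obtain ⟨s, hs, rfl⟩ := mem_proj.1 ht
      exact erase_subset_erase b (hFu s hs)
    · rw [card_diffs_proj_of_twin hab hne, card_proj_of_twin hab hne]
      exact hF
    · exact ⟨t₀.erase b, mem_proj.2 ⟨t₀, ht₀, rfl⟩, mem_erase.2 ⟨hne, hat₀⟩⟩
    · obtain ⟨s, hs, has⟩ := hout
      exact ⟨s.erase b, mem_proj.2 ⟨s, hs, rfl⟩, fun h => has (mem_of_mem_erase h)⟩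

/-- **(SD), class form.** If `|F \\ F| ≤ |F| + 1` and `a` lies in some member and outside some
member of `F`, then the twin class of `a` is a difference of `F`. -/
theorem cls_mem_diffs_of_card_diffs_le {F : Finset (Finset α)}
    (hF : (F \\ F).card ≤ F.card + 1) {a : α} (hin : ∃ t ∈ F, a ∈ t) (hout : ∃ t ∈ F, a ∉ t) :
    cls F a ∈ F \\ F :=
  cls_mem_diffs_of_card_diffs_le_aux univ F (fun _ _ => subset_univ _) hF a hin hout

end ClassForm

end PercRepro.MSTight
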